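import Summits.ABC.ABC.Theses.DefiniteXi
import Summits.ABC.ABC.Theorems.DefiniteXiFreyModularity
import Summits.ABC.ABC.Theorems.DefiniteXiDefiniteRTControlPrimeSmulTransportDeg
import Summits.ABC.ABC.Theorems.DefiniteXiDefiniteRTControlPrimeValTransport
import Summits.ABC.ABC.Theorems.DefiniteXiDefiniteRTControlPrimeFreyScale
import Summits.ABC.ABC.Theorems.DefiniteXiDefiniteRTControlPrimeFreyLocal
import Literature.NumberTheory.EllipticCurves.TakahashiDegreeFormulaCoprimeProofs
import Literature.NumberTheory.EllipticCurves.PastenSpectralDegree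
import Literature.NumberTheory.EllipticCurves.PastenHeightBounds
import Literature.NumberTheory.EllipticCurves.PastenHeightBoundsLemma68LocalProofs
import Literature.NumberTheory.EllipticCurves.PastenSpectralDegreeIsogenyBoundProofs
import Literature.NumberTheory.EllipticCurves.ModularCurveManinSemistableBridgeProofs
import Literature.NumberTheory.EllipticCurves.ModularDegreeMinimal
import Literature.NumberTheory.EllipticCurves.IsogenyVariableChangeProofs
import Literature.NumberTheory.EllipticCurves.IsogenyCompProofs
import Literature.NumberTheory.EllipticCurves.IsogenyDualProofs
import Literature.NumberTheory.Automorphic.ShimuraCurveTakahashiCoordinateInputs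
import Literature.NumberTheory.Automorphic.ShimuraParametrizationSplitDegreeProofs
import Literature.NumberTheory.Automorphic.ShimuraCurveDataExistence
import HarnessLib

/-!
# STUB-IDEAS `stub_takahashi` — ideator k2, generation 3 (home family 2: RESHAPE) — typed companion

Crux `DefiniteXi.DefiniteRTControlPrime` (stmt-ABC-11338), registered skeleton
`Cruxes/DefiniteRTControlPrime/Lines/Sketch.lean` (`DefiniteRTControlPrime_of`, `C = 4·163²`),
stub `stub_takahashi : takahashi2001_thm_2_3_of_coprime` (named fact, one-curve idiom: the
conductor-restricted-minimal datum `P⋆` of a curve `W⋆` of conductor `M r`).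

## The reshape (gen 3): instantiate Takahashi in the TWO-CURVE idiom the crux already lives in

The crux hands us a REFERENCE curve of KNOWN conductor `N = M q` — the Frey model
`W_m = C • freyCurve a b` (`hN`, `conductorNorm_smul_rat`) — and the chain only needs Takahashi's
inequality for the OPTIMAL QUOTIENT `(W₀, D₀)` of its class (`exists_optimalDatum'`), whose
conductor the tree cannot certify (`LevelIsConductor` / Carayol / Ogg–Saito at `2`).  The tree's
BSD-side twin `takahashi2001_thm_2_3_shimura_level` (ShimuraCurveTakahashiCoordinateInputs:247, all
`D`, arbitrary cofactor; ALREADY a named input of BSD/PastenComponentOrdersInput) is stated in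
exactly this idiom: reference curve `W` with `W.conductorNorm ℤ = N`, FLOATING carrier `W'` of a
class-minimal Shimura datum (`IsMinimalFor W`).  At `D = 1` the three idiom gaps are tree THEOREMS:
`nonempty_shimuraCurveData_holds`, `exists_shimuraParametrizationData_deg_eq_modularDegree`,
`ShimuraParametrizationData.modularDegree_dvd_deg` (so the transported `D₀` is class-minimal for
`W_m`: `isMinimalFor_of_transport`), and `XiSetup M (1·q) = XiSetup M q` by `Nat.one_mul`.

Hence (all PROVED below, 0 sorries):
* `takahashiTriple_of_twin` — Thm 2.3 (`0 < i`, `i j = c_q(W₀)`, `i ∣ ξ`, `δ₀ i = ξ j`) for the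
  optimal quotient `(W₀, D₀)` of the class of ANY curve `W` of conductor `M q` carrying the newform:
  the content of gen-2's `T_opt`, from the twin, with NO Carayol / LevelIsConductor / modularity;
* `modularDegree_le_brandtXi_mul_of_twin` — the drop-in for the skeleton's `hTak` line;
* `definiteRTControlPrime_of_twin : twin → Pasten163 → Lemma68 → DefiniteRTControlPrime` — the
  crux on the trust base {twin, 163, 6.8}: the conductor-restricted pivot `exists_conductorMinimal`,
  `h0s` and the named fact `takahashi2001_thm_2_3_of_coprime` leave the critical path; the tree's
  named-fact count on this line drops by one (the twin is consumed by BSD anyway).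

k1-g3 found the twin match but kept the stub's one-curve idiom and therefore pays
`LevelIsConductor (M r)` (unconditional only at square-free level); k2-g2 re-cut to the optimal
idiom but introduced a NEW fact `T_opt`.  This file is the synthesis: re-cut to the twin's idiom —
no new fact, no level hypothesis.

## T2 (second reshape): the weakest consumed form `TakahashiBoundInClass`

The composition uses Takahashi only as ONE inequality for ONE (floating) member of the isogeny
class: `∃ W' P', P'.f = f ∧ deg P' ≤ brandtXi M q (a W') · v_q(Δ_min W')` — no `i, j`, no
minimality, no conductor clause on the member.  PROVED: `boundInClass_of_coprime` (member = the
conductor-restricted pivot), `boundInClass_of_twin` (member = the optimal quotient),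
`definiteRTControlPrime_of_boundInClass` (the crux, same constant), and the factorisations
`definiteRTControlPrime_of_facts'` / `definiteRTControlPrime_of_twin'` through the interface.

Imports: the landed closing module `Theorems/DefiniteXiDefiniteRTControlPrime.lean` is not built
on the farm snapshot, so its import list is reproduced and its two folklore helpers
(`isIsogenous_of_f_eq'`, `exists_conductorMinimal'`) are restated with their landed proofs.
`lean check`: rc 0, 0 sorries.
-/

set_option linter.dupNamespace false

noncomputable section

namespace Summit.ABC.ABC.Cruxes.DefiniteRTControlPrime.StubIdeas2G3

open Summit.ABC.ABC.Theses.DefiniteXi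
open Literature.NumberTheory.EllipticCurves Literature.NumberTheory.EllipticCurves.ModularForms
open Literature.NumberTheory.Automorphic
open WeierstrassCurve
open Summit.ABC.ABC.Theorems.DefiniteRTControlPrime

/-! ## K1 — the transported optimal datum is class-minimal for the reference curve -/

/-- **K1.** For `X : ShimuraCurveData 1 N`, a classical datum `D₀` of `W₀` of minimal degree among
ALL data at level `N` with its newform (the lattice-optimal datum), a reference curve `W` carrying
that newform, and a Shimura datum `Q` of `W₀` on `X` with `deg Q = deg D₀`: `Q.IsMinimalFor W`
(`W ∼ W₀` by Faltings through `IsNewformOf.isIsogenous`; every Shimura datum of the class has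
degree divisible by `deg D₀`, `ShimuraParametrizationData.modularDegree_dvd_deg`).  Generalises
k1-g3's `isMinimalFor_of_classMinimal` (there `W₀ = W`). -/
theorem isMinimalFor_of_transport {N : ℕ} [NeZero N] {X : ShimuraCurveData 1 N}
    {W W₀ : WeierstrassCurve ℚ} [W.IsElliptic] [W₀.IsElliptic]
    (D₀ : ModularParametrizationData W₀ N) (hf : IsNewformOf W D₀.f)
    (hmin₀ : ∀ (W₂ : WeierstrassCurve ℚ) [W₂.IsElliptic] (D₂ : ModularParametrizationData W₂ N),
      D₂.f = D₀.f → D₀.modularDegree ≤ D₂.modularDegree)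
    (Q : ShimuraParametrizationData X W₀) (hQ : Q.deg = D₀.modularDegree) : Q.IsMinimalFor W :=
  ⟨IsNewformOf.isIsogenous WeierstrassCurve.isIsogenous_iff_frobeniusTrace_eq_holds hf
      D₀.isNewformOf,
    fun W'' _ P'' hiso => by
      rw [hQ]
      exact Nat.le_of_dvd P''.deg_pos (P''.modularDegree_dvd_deg hiso D₀ hf hmin₀)⟩

/-! ## K2 — Takahashi's Theorem 2.3 for the optimal quotient, from the twin at `D = 1` -/

/-- **K2 (the triple).** From the twin `takahashi2001_thm_2_3_shimura_level` at
`(N, D, M, p, m) = (M q, 1, M q, q, M)`: for every curve `W` of conductor `M q` (`q` prime,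
`gcd(M, q) = 1`), every lattice-optimal datum `D₀` (carrier `W₀`) of the newform of `W`, and every
Brandt setup `S` of type `(M, q)`: `∃ i j, 0 < i ∧ i j = ord_q Δ_min(W₀) ∧ i ∣ ξ_S(a(W₀)) ∧
deg D₀ · i = ξ_S(a(W₀)) · j` — Takahashi 2001 Thm 2.3 for the optimal quotient, with no hypothesis
on the conductor of `W₀`. [cite: Takahashi2001, Thm. 2.3 (p. 79)] -/
theorem takahashiTriple_of_twin (hT : takahashi2001_thm_2_3_shimura_level)
    {W W₀ : WeierstrassCurve ℚ} [W.IsElliptic] [W₀.IsElliptic] (M q : ℕ) [NeZero (M * q)]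
    (hq : q.Prime) (hcop : M.Coprime q) (hWN : W.conductorNorm ℤ = M * q)
    (D₀ : ModularParametrizationData W₀ (M * q)) (hf : IsNewformOf W D₀.f)
    (hmin₀ : ∀ (W₂ : WeierstrassCurve ℚ) [W₂.IsElliptic]
      (D₂ : ModularParametrizationData W₂ (M * q)), D₂.f = D₀.f →
        D₀.modularDegree ≤ D₂.modularDegree)
    (S : Brandt.XiSetup M q) :
    ∃ i j : ℕ, 0 < i ∧ i * j = (W₀.minimalDiscriminantNorm ℤ).factorization q ∧
      i ∣ S.xi (fun n => W₀.LFunction n) ∧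
      D₀.modularDegree * i = S.xi (fun n => W₀.LFunction n) * j := by
  have hpos : 0 < M * q := Nat.pos_of_ne_zero (NeZero.ne _)
  have hadm : IsAdmissibleFactorization (M * q) 1 (M * q) := isAdmissibleFactorization_one hpos
  obtain ⟨X⟩ := nonempty_shimuraCurveData_holds hadm
  obtain ⟨Q, hQ⟩ := exists_shimuraParametrizationData_deg_eq_modularDegree X D₀
  have hQmin : Q.IsMinimalFor W := isMinimalFor_of_transport D₀ hf hmin₀ Q hQ
  have hqM : ¬ q ∣ M := by
    intro h
    have hg : Nat.gcd M q = 1 := hcop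
    have h1 : q ∣ Nat.gcd M q := Nat.dvd_gcd h (dvd_refl q)
    rw [hg] at h1
    exact hq.one_lt.ne' (Nat.dvd_one.mp h1)
  have key := hT hq (Nat.mul_comm M q) hqM hadm X W hWN W₀ Q hQmin
  rw [Nat.one_mul] at key
  obtain ⟨i, j, hi, hij, hdvd, hδ⟩ := key S
  exact ⟨i, j, hi, hij, hdvd, by rw [← hQ]; exact hδ⟩

/-- **K2′ (drop-in for the skeleton's `hTak`).** `deg D₀ ≤ brandtXi M q (a(W₀)) · ord_q Δ_min(W₀)`
for the lattice-optimal datum `D₀` of the class of a curve `W` of conductor `M q` — from K2 in the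
chosen setup (`exists_brandtXi_eq`, setups exist: `nonempty_xiSetup'`). [cite: Takahashi2001, Thm. 2.3 (p. 79)] -/
theorem modularDegree_le_brandtXi_mul_of_twin (hT : takahashi2001_thm_2_3_shimura_level)
    {W W₀ : WeierstrassCurve ℚ} [W.IsElliptic] [W₀.IsElliptic] (M q : ℕ) [NeZero (M * q)]
    (hq : q.Prime) (hcop : M.Coprime q) (hWN : W.conductorNorm ℤ = M * q)
    (D₀ : ModularParametrizationData W₀ (M * q)) (hf : IsNewformOf W D₀.f)
    (hmin₀ : ∀ (W₂ : WeierstrassCurve ℚ) [W₂.IsElliptic]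
      (D₂ : ModularParametrizationData W₂ (M * q)), D₂.f = D₀.f →
        D₀.modularDegree ≤ D₂.modularDegree) :
    D₀.modularDegree ≤
      brandtXi M q (fun n => W₀.LFunction n) * (W₀.minimalDiscriminantNorm ℤ).factorization q := by
  obtain ⟨S, hS⟩ := exists_brandtXi_eq
    (takahashi2001_thm_2_3_of_coprime.nonempty_xiSetup' hq hcop) (fun n => W₀.LFunction n)
  rw [hS]
  obtain ⟨i, j, hi, hij, -, hδ⟩ := takahashiTriple_of_twin hT M q hq hcop hWN D₀ hf hmin₀ S
  calc D₀.modularDegree ≤ D₀.modularDegree * i := Nat.le_mul_of_pos_right _ hi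
    _ = S.xi (fun n => W₀.LFunction n) * j := hδ
    _ ≤ S.xi (fun n => W₀.LFunction n) * (i * j) :=
        Nat.mul_le_mul_left _ (Nat.le_mul_of_pos_left _ hi)
    _ = _ := by rw [hij]

/-! ## K3 — the re-cut composition: the crux on the trust base {twin, Pasten 163, Lemma 6.8} -/

/-- Verbatim `Summit.ABC.ABC.Theorems.DefiniteRTControlPrime.isIsogenous_of_f_eq` (LANDED, p97354,
`Theorems/DefiniteXiDefiniteRTControlPrime.lean:86`, proof copied) — restated here only because that
module is not built on the farm snapshot (`remote:stale:unbuilt`); two curves carrying data with the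
same newform are `ℚ`-isogenous. [folklore] -/
theorem isIsogenous_of_f_eq' {W W' : WeierstrassCurve ℚ} [W.IsElliptic] [W'.IsElliptic] {N : ℕ}
    [NeZero N] (D : ModularParametrizationData W N) (D' : ModularParametrizationData W' N)
    (hf : D'.f = D.f) : W.IsIsogenous W' := by
  obtain ⟨W₀, hW₀, D₀, hf₀, h₀⟩ := D.exists_optimalDatum'
  haveI := hW₀
  have key : ∀ {V : WeierstrassCurve ℚ} [V.IsElliptic] (P : ModularParametrizationData V N),
      P.f = D₀.f → W₀.IsIsogenous V := by
    intro V _ P hP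
    have hc₀ : (D₀.c : ℚ) ≠ 0 := by exact_mod_cast D₀.maninConstant_ne_zero_holds
    have hc : (P.c : ℚ) ≠ 0 := by exact_mod_cast P.maninConstant_ne_zero_holds
    refine isIsogenous_of_forall_mul_mem_lattice D₀.isNeronLattice.1 D₀.isNeronLattice.2
      P.isNeronLattice.1 P.isNeronLattice.2 (c := (P.c : ℚ) / D₀.c) (div_ne_zero hc hc₀) ?_
    intro z hz
    obtain ⟨w, hw, rfl⟩ := h₀ z hz
    have hw' : w ∈ periodLattice P.f := by rw [hP]; exact hw
    have : (((P.c : ℚ) / D₀.c : ℚ) : ℂ) * ((D₀.c : ℂ) * w) = (P.c : ℂ) * w := by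
      have hc₀' : (D₀.c : ℂ) ≠ 0 := D₀.cast_c_ne_zero
      push_cast
      field_simp
    rw [this]
    exact P.smul_periodLattice_le w hw'
  have h1 : W₀.IsIsogenous W := key D hf₀.symm
  have h2 : W₀.IsIsogenous W' := key D' (hf.trans hf₀.symm)
  exact h1.symm_of_charZero.trans' h2

/-- **K3.** `DefiniteRTControlPrime` from the twin, Pasten's `163`-fact and Lemma 6.8 — the landed
`definiteRTControlPrime_of_facts` with the conductor-restricted pivot `(W⋆, P⋆)` deleted: Takahashi
is applied to the optimal quotient `(W₀, D₀)` with the Frey model `W_m` (conductor `M q`, known) as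
reference curve.  Chain: `deg D ≤ 4 deg D₁ ≤ 4·163 deg D₀ ≤ 4·163 ξ v_q(Δ_min W₀) ≤ 4·163² ξ v_q(Δ_min E)`.
[cite: Takahashi2001, Thm. 2.3 (p. 79)] [cite: PastenShimura2024, §3 p. 13 and Lemma 6.8 (p. 22)] -/
theorem definiteRTControlPrime_of_twin (hTw : takahashi2001_thm_2_3_shimura_level)
    (h163 : PastenShimura2024_minimalDegree_le_163_mul) (h68 : PastenShimura2024_lemma_6_8) :
    DefiniteRTControlPrime := by
  intro ε hε
  refine ⟨4 * 163 * 163, ?_⟩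
  intro a b hab h0 N _ hN q hq hq2 hqN D hDmin
  -- `N = M q`
  obtain ⟨M, hM⟩ := hqN
  rw [mul_comm] at hM
  subst hM
  haveI := isElliptic_freyCurve h0
  have hdiv : M * q / q = M := Nat.mul_div_cancel M hq.pos
  rw [hdiv]
  have hqN' : q ∣ (freyCurve a b).conductorNorm ℤ := by rw [hN]; exact Dvd.intro_left M rfl
  -- `gcd(M, q) = 1`
  have hcop : M.Coprime q := by
    have h := stub_freyLocal a b hab h0 q hq hq2 hqN'
    rwa [hN, hdiv] at h
  -- a global minimal model `W_m = C • E`, its data, a minimal one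
  obtain ⟨C, hC⟩ := hasGlobalMinimalModel_rat_holds (freyCurve a b)
  haveI := hC
  have hNm : (C • freyCurve a b).conductorNorm ℤ = M * q := by rw [conductorNorm_smul_rat, hN]
  have hne : Nonempty (ModularParametrizationData (C • freyCurve a b) (M * q)) :=
    (Summit.ABC.ABC.Theorems.nonempty_modularParametrizationData_smul_iff C).mpr ⟨D⟩
  obtain ⟨D₁, -, hD₁min⟩ := exists_minimal_datum hne
  -- the lattice-optimal datum of the class of `f₁ := D₁.f`
  obtain ⟨W₀, hW₀, D₀, hf₀, h₀⟩ := D₁.exists_optimalDatum'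
  haveI := hW₀
  have hker₀ : D₀.isogenyMap.ker = ⊥ := D₀.isogenyMap_ker_eq_bot_iff.mpr h₀
  have hmin₀ : ∀ (W' : WeierstrassCurve ℚ) [W'.IsElliptic]
      (D' : ModularParametrizationData W' (M * q)), D'.f = D₀.f →
        D₀.modularDegree ≤ D'.modularDegree := fun W' _ D' hD' =>
    D₀.modularDegree_le_of_isogenyMap_ker_eq_bot hker₀ D' hD'
  -- (T_deg) `deg D₁ ≤ 163 · deg D₀`
  have h163' : D₁.modularDegree ≤ 163 * D₀.modularDegree :=
    h163 (M * q) W₀ (C • freyCurve a b) D₀ D₁ hf₀.symm hmin₀ hD₁min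
  -- Takahashi for the optimal quotient `(W₀, D₀)`, reference curve `W_m` (conductor `M q`)
  have hf : IsNewformOf (C • freyCurve a b) D₀.f := by rw [hf₀]; exact D₁.isNewformOf
  have hTak : D₀.modularDegree ≤ brandtXi M q (fun n => W₀.LFunction n) *
      (W₀.minimalDiscriminantNorm ℤ).factorization q :=
    modularDegree_le_brandtXi_mul_of_twin hTw M q hq hcop hNm D₀ hf hmin₀
  -- `a(W₀) = a(f₁) = a(W_m) = a(E)`
  have hL : (fun n => W₀.LFunction n) = fun n => (freyCurve a b).LFunction n := by
    funext n
    have h1 := D₀.isNewformOf.2 n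
    have h2 := D₁.isNewformOf.2 n
    rw [hf₀] at h1
    rw [h1, LFunction_smul] at h2
    exact_mod_cast h2
  rw [hL] at hTak
  -- (T_val) along `E ~ W_m ~ W₀`
  have hiso : (freyCurve a b).IsIsogenous W₀ :=
    (isIsogenous_smul (freyCurve a b) C).trans' (isIsogenous_of_f_eq' D₁ D₀ hf₀)
  have hval : (W₀.minimalDiscriminantNorm ℤ).factorization q ≤
      163 * ((freyCurve a b).minimalDiscriminantNorm ℤ).factorization q :=
    stub_valTransport h68 a b hab h0 q hq hq2 hqN' W₀ hiso
  -- (T_model) back to the Frey model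
  obtain ⟨D₁', -, hdeg₁'⟩ := stub_smulTransportDeg C D₁
  have hscale : (C.u : ℚ).num.natAbs ≤ 2 := stub_freyScale a b hab h0 C hC
  have hD : D.deg ≤ 4 * D₁.modularDegree := by
    calc D.deg ≤ D₁'.deg := hDmin D₁'
      _ = (C.u : ℚ).num.natAbs ^ 2 * D₁.deg := hdeg₁'
      _ ≤ 2 ^ 2 * D₁.deg := Nat.mul_le_mul_right _ (Nat.pow_le_pow_left hscale 2)
      _ = 4 * D₁.modularDegree := by norm_num [ModularParametrizationData.modularDegree]
  -- the chain in `ℕ` (one step shorter than the skeleton's: no `h0s`)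
  set ξ : ℕ := brandtXi M q (fun n => (freyCurve a b).LFunction n) with hξ
  set v : ℕ := ((freyCurve a b).minimalDiscriminantNorm ℤ).factorization q with hv
  have hchain : D.deg ≤ 4 * 163 * 163 * (ξ * v) :=
    calc D.deg ≤ 4 * D₁.modularDegree := hD
      _ ≤ 4 * (163 * D₀.modularDegree) := Nat.mul_le_mul_left _ h163'
      _ ≤ 4 * (163 * (ξ * (W₀.minimalDiscriminantNorm ℤ).factorization q)) :=
          Nat.mul_le_mul_left _ (Nat.mul_le_mul_left _ hTak)
      _ ≤ 4 * (163 * (ξ * (163 * v))) :=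
          Nat.mul_le_mul_left _ (Nat.mul_le_mul_left _ (Nat.mul_le_mul_left _ hval))
      _ = 4 * 163 * 163 * (ξ * v) := by ring
  -- to `ℝ`, inserting the idle `N^ε ≥ 1`
  have hN1 : (1 : ℝ) ≤ ((M * q : ℕ) : ℝ) := by
    exact_mod_cast Nat.one_le_iff_ne_zero.mpr (NeZero.ne (M * q))
  have hrpow : (1 : ℝ) ≤ ((M * q : ℕ) : ℝ) ^ ε := Real.one_le_rpow hN1 hε.le
  have hcast : (D.deg : ℝ) ≤ (4 * 163 * 163 : ℝ) * ((ξ : ℝ) * (v : ℝ)) := by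
    exact_mod_cast hchain
  have hξv : (0 : ℝ) ≤ (ξ : ℝ) * (v : ℝ) := by positivity
  calc (D.deg : ℝ) ≤ (4 * 163 * 163 : ℝ) * ((ξ : ℝ) * (v : ℝ)) := hcast
    _ = (4 * 163 * 163 : ℝ) * 1 * ((ξ : ℝ) * (v : ℝ)) := by ring
    _ ≤ (4 * 163 * 163 : ℝ) * ((M * q : ℕ) : ℝ) ^ ε * ((ξ : ℝ) * (v : ℝ)) := by gcongr

/-- **K3′ (Mazur–Kenku trust base).** As `definiteRTControlPrime_of_mazurKenku`: Lemma 6.8 is a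
theorem over `mazurKenku_exists_cyclic_isogeny`, so the crux follows from the twin, the `163`-fact
and Mazur–Kenku. [cite: Mazur1978, Thm. 1] [cite: Kenku1982] -/
theorem definiteRTControlPrime_of_twin_of_mazurKenku (hTw : takahashi2001_thm_2_3_shimura_level)
    (h163 : PastenShimura2024_minimalDegree_le_163_mul) (hMK : mazurKenku_exists_cyclic_isogeny) :
    DefiniteRTControlPrime :=
  definiteRTControlPrime_of_twin hTw h163 (PastenShimura2024_lemma_6_8_of_mazurKenku' hMK)

/-! ## T2 — the WEAKEST CONSUMED FORM: a Takahashi bound for SOME datum in the isogeny class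

The composition (K3, and the landed `definiteRTControlPrime_of_facts`) consumes Takahashi only as
ONE inequality for ONE member of the class of the newform — `deg P' ≤ ξ_{(M,q)}(a(W'))·v_q(Δ_min W')`
for some `W' ∼ W_m` with `P'.f = f₁` — and the member may FLOAT: class-minimality of `D₀`
(`deg D₀ ≤ deg P'`), Lemma 6.8 (`v_q(Δ_min W') ≤ 163 v_q(Δ_min E)`) and `a(W') = a(E)` absorb the
choice.  `TakahashiBoundInClass` is that interface (no minimality clause, no conductor clause on
the member, no `i, j`).  BOTH typed renderings of Thm 2.3 imply it UNCONDITIONALLY — the classical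
fact with member = the conductor-restricted-minimal pivot, the twin with member = the optimal
quotient — and it closes the crux with the same constant. -/

/-- Verbatim `Summit.ABC.ABC.Theorems.DefiniteRTControlPrime.exists_conductorMinimal` (LANDED,
p97354; proof copied; restated because that module is unbuilt on the farm): the conductor-restricted
optimal pivot as a well-founded minimum. [folklore] -/
theorem exists_conductorMinimal' {V : WeierstrassCurve ℚ} [V.IsElliptic] {N : ℕ} [NeZero N]
    (D₁ : ModularParametrizationData V N) (hV : V.conductorNorm ℤ = N) :
    ∃ (Ws : WeierstrassCurve ℚ) (_ : Ws.IsElliptic) (Ps : ModularParametrizationData Ws N),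
      Ws.conductorNorm ℤ = N ∧ Ps.f = D₁.f ∧
      ∀ (W' : WeierstrassCurve ℚ) [W'.IsElliptic], W'.conductorNorm ℤ = N →
        ∀ P' : ModularParametrizationData W' N, P'.f = Ps.f →
          Ps.modularDegree ≤ P'.modularDegree := by
  classical
  set S : Set ℕ := {d | ∃ (W' : WeierstrassCurve ℚ) (_ : W'.IsElliptic)
      (P' : ModularParametrizationData W' N),
      W'.conductorNorm ℤ = N ∧ P'.f = D₁.f ∧ P'.modularDegree = d} with hS_def
  have hS : S.Nonempty := ⟨D₁.modularDegree, V, ‹_›, D₁, hV, rfl, rfl⟩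
  obtain ⟨Ws, hWs, Ps, hNs, hfs, hdeg⟩ := Nat.sInf_mem hS
  refine ⟨Ws, hWs, Ps, hNs, hfs, fun W' _ hW' P' hP' => ?_⟩
  rw [hdeg]
  exact Nat.sInf_le ⟨W', ‹_›, P', hW', hP'.trans hfs, rfl⟩

/-- **T2 (interface). A Takahashi bound somewhere in the class.** For `q` prime, `gcd(M, q) = 1`,
`W` of conductor `M q` with a datum `D` at level `M q`: SOME elliptic `W'/ℚ` carries a datum `P'`
with the same newform and `deg P' ≤ brandtXi M q (a(W')) · ord_q Δ_min(W')`.  Weaker than both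
`takahashi2001_thm_2_3_of_coprime` (`boundInClass_of_coprime`) and
`takahashi2001_thm_2_3_shimura_level` (`boundInClass_of_twin`); sufficient for the crux
(`definiteRTControlPrime_of_boundInClass`). [cite: Takahashi2001, Thm. 2.3 (p. 79)] -/
def TakahashiBoundInClass : Prop :=
  ∀ (W : WeierstrassCurve ℚ) [W.IsElliptic] (M q : ℕ) [NeZero (M * q)],
    q.Prime → M.Coprime q → W.conductorNorm ℤ = M * q →
    ∀ D : ModularParametrizationData W (M * q),
      ∃ (W' : WeierstrassCurve ℚ) (_ : W'.IsElliptic) (P' : ModularParametrizationData W' (M * q)),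
        P'.f = D.f ∧
        P'.modularDegree ≤
          brandtXi M q (fun n => W'.LFunction n) * (W'.minimalDiscriminantNorm ℤ).factorization q

/-- **T2a.** The classical fact gives the interface, member = the conductor-restricted-minimal
pivot (`exists_conductorMinimal'` + the tree corollary `modularDegree_le_brandtXi_mul`); no
Carayol, no level hypothesis. [cite: Takahashi2001, Thm. 2.3 (p. 79)] -/
theorem boundInClass_of_coprime (h : takahashi2001_thm_2_3_of_coprime) : TakahashiBoundInClass := by
  intro W _ M q _ hq hcop hWN D
  obtain ⟨Ws, hWs, Ps, hNs, hfs, hmins⟩ := exists_conductorMinimal' D hWN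
  haveI := hWs
  exact ⟨Ws, hWs, Ps, hfs,
    takahashi2001_thm_2_3_of_coprime.modularDegree_le_brandtXi_mul h Ws M q hq hcop hNs Ps hmins⟩

/-- **T2b.** The twin gives the interface, member = the optimal quotient of the class
(`exists_optimalDatum'` + K2′). [cite: Takahashi2001, Thm. 2.3 (p. 79)] -/
theorem boundInClass_of_twin (hT : takahashi2001_thm_2_3_shimura_level) : TakahashiBoundInClass := by
  intro W _ M q _ hq hcop hWN D
  obtain ⟨W₀, hW₀, D₀, hf₀, h₀⟩ := D.exists_optimalDatum'
  haveI := hW₀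
  have hker₀ : D₀.isogenyMap.ker = ⊥ := D₀.isogenyMap_ker_eq_bot_iff.mpr h₀
  have hmin₀ : ∀ (W₂ : WeierstrassCurve ℚ) [W₂.IsElliptic]
      (D₂ : ModularParametrizationData W₂ (M * q)), D₂.f = D₀.f →
        D₀.modularDegree ≤ D₂.modularDegree := fun W₂ _ D₂ hD₂ =>
    D₀.modularDegree_le_of_isogenyMap_ker_eq_bot hker₀ D₂ hD₂
  have hf : IsNewformOf W D₀.f := by rw [hf₀]; exact D.isNewformOf
  exact ⟨W₀, hW₀, D₀, hf₀, modularDegree_le_brandtXi_mul_of_twin hT M q hq hcop hWN D₀ hf hmin₀⟩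

/-- **T2c. The crux from the interface** (and the two Pasten facts), `C = 4·163²`, `N^ε` idle:
`deg D ≤ 4 deg D₁ ≤ 4·163 deg D₀ ≤ 4·163 deg P' ≤ 4·163 ξ v_q(Δ_min W') ≤ 4·163² ξ v_q(Δ_min E)`
with `(W', P')` the floating member handed by `TakahashiBoundInClass`.
[cite: Takahashi2001, Thm. 2.3 (p. 79)] [cite: PastenShimura2024, §3 p. 13 and Lemma 6.8 (p. 22)] -/
theorem definiteRTControlPrime_of_boundInClass (hB : TakahashiBoundInClass)
    (h163 : PastenShimura2024_minimalDegree_le_163_mul) (h68 : PastenShimura2024_lemma_6_8) :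
    DefiniteRTControlPrime := by
  intro ε hε
  refine ⟨4 * 163 * 163, ?_⟩
  intro a b hab h0 N _ hN q hq hq2 hqN D hDmin
  obtain ⟨M, hM⟩ := hqN
  rw [mul_comm] at hM
  subst hM
  haveI := isElliptic_freyCurve h0
  have hdiv : M * q / q = M := Nat.mul_div_cancel M hq.pos
  rw [hdiv]
  have hqN' : q ∣ (freyCurve a b).conductorNorm ℤ := by rw [hN]; exact Dvd.intro_left M rfl
  have hcop : M.Coprime q := by
    have h := stub_freyLocal a b hab h0 q hq hq2 hqN'
    rwa [hN, hdiv] at h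
  obtain ⟨C, hC⟩ := hasGlobalMinimalModel_rat_holds (freyCurve a b)
  haveI := hC
  have hNm : (C • freyCurve a b).conductorNorm ℤ = M * q := by rw [conductorNorm_smul_rat, hN]
  have hne : Nonempty (ModularParametrizationData (C • freyCurve a b) (M * q)) :=
    (Summit.ABC.ABC.Theorems.nonempty_modularParametrizationData_smul_iff C).mpr ⟨D⟩
  obtain ⟨D₁, -, hD₁min⟩ := exists_minimal_datum hne
  obtain ⟨W₀, hW₀, D₀, hf₀, h₀⟩ := D₁.exists_optimalDatum'
  haveI := hW₀
  have hker₀ : D₀.isogenyMap.ker = ⊥ := D₀.isogenyMap_ker_eq_bot_iff.mpr h₀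
  have hmin₀ : ∀ (W' : WeierstrassCurve ℚ) [W'.IsElliptic]
      (D' : ModularParametrizationData W' (M * q)), D'.f = D₀.f →
        D₀.modularDegree ≤ D'.modularDegree := fun W' _ D' hD' =>
    D₀.modularDegree_le_of_isogenyMap_ker_eq_bot hker₀ D' hD'
  have h163' : D₁.modularDegree ≤ 163 * D₀.modularDegree :=
    h163 (M * q) W₀ (C • freyCurve a b) D₀ D₁ hf₀.symm hmin₀ hD₁min
  -- the interface: a floating member `(W', P')` of the class of `f₁` with Takahashi's bound
  obtain ⟨W', hW', P', hf', hTak⟩ := hB (C • freyCurve a b) M q hq hcop hNm D₁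
  haveI := hW'
  have h0' : D₀.modularDegree ≤ P'.modularDegree := hmin₀ W' P' (hf'.trans hf₀.symm)
  have hL : (fun n => W'.LFunction n) = fun n => (freyCurve a b).LFunction n := by
    funext n
    have h1 := P'.isNewformOf.2 n
    have h2 := D₁.isNewformOf.2 n
    rw [hf'] at h1
    rw [h1, LFunction_smul] at h2
    exact_mod_cast h2
  rw [hL] at hTak
  have hiso : (freyCurve a b).IsIsogenous W' :=
    (isIsogenous_smul (freyCurve a b) C).trans' (isIsogenous_of_f_eq' D₁ P' hf')
  have hval : (W'.minimalDiscriminantNorm ℤ).factorization q ≤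
      163 * ((freyCurve a b).minimalDiscriminantNorm ℤ).factorization q :=
    stub_valTransport h68 a b hab h0 q hq hq2 hqN' W' hiso
  obtain ⟨D₁', -, hdeg₁'⟩ := stub_smulTransportDeg C D₁
  have hscale : (C.u : ℚ).num.natAbs ≤ 2 := stub_freyScale a b hab h0 C hC
  have hD : D.deg ≤ 4 * D₁.modularDegree := by
    calc D.deg ≤ D₁'.deg := hDmin D₁'
      _ = (C.u : ℚ).num.natAbs ^ 2 * D₁.deg := hdeg₁'
      _ ≤ 2 ^ 2 * D₁.deg := Nat.mul_le_mul_right _ (Nat.pow_le_pow_left hscale 2)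
      _ = 4 * D₁.modularDegree := by norm_num [ModularParametrizationData.modularDegree]
  set ξ : ℕ := brandtXi M q (fun n => (freyCurve a b).LFunction n) with hξ
  set v : ℕ := ((freyCurve a b).minimalDiscriminantNorm ℤ).factorization q with hv
  have hchain : D.deg ≤ 4 * 163 * 163 * (ξ * v) :=
    calc D.deg ≤ 4 * D₁.modularDegree := hD
      _ ≤ 4 * (163 * D₀.modularDegree) := Nat.mul_le_mul_left _ h163'
      _ ≤ 4 * (163 * P'.modularDegree) := Nat.mul_le_mul_left _ (Nat.mul_le_mul_left _ h0')
      _ ≤ 4 * (163 * (ξ * (W'.minimalDiscriminantNorm ℤ).factorization q)) :=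
          Nat.mul_le_mul_left _ (Nat.mul_le_mul_left _ hTak)
      _ ≤ 4 * (163 * (ξ * (163 * v))) :=
          Nat.mul_le_mul_left _ (Nat.mul_le_mul_left _ (Nat.mul_le_mul_left _ hval))
      _ = 4 * 163 * 163 * (ξ * v) := by ring
  have hN1 : (1 : ℝ) ≤ ((M * q : ℕ) : ℝ) := by
    exact_mod_cast Nat.one_le_iff_ne_zero.mpr (NeZero.ne (M * q))
  have hrpow : (1 : ℝ) ≤ ((M * q : ℕ) : ℝ) ^ ε := Real.one_le_rpow hN1 hε.le
  have hcast : (D.deg : ℝ) ≤ (4 * 163 * 163 : ℝ) * ((ξ : ℝ) * (v : ℝ)) := by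
    exact_mod_cast hchain
  have hξv : (0 : ℝ) ≤ (ξ : ℝ) * (v : ℝ) := by positivity
  calc (D.deg : ℝ) ≤ (4 * 163 * 163 : ℝ) * ((ξ : ℝ) * (v : ℝ)) := hcast
    _ = (4 * 163 * 163 : ℝ) * 1 * ((ξ : ℝ) * (v : ℝ)) := by ring
    _ ≤ (4 * 163 * 163 : ℝ) * ((M * q : ℕ) : ℝ) ^ ε * ((ξ : ℝ) * (v : ℝ)) := by gcongr

/-- **T2d.** Hence the landed closing theorem factors through the interface:
`of_coprime → 163 → 6.8 → crux` is `definiteRTControlPrime_of_boundInClass ∘ boundInClass_of_coprime`,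
and K3 is `… ∘ boundInClass_of_twin`. [cite: Takahashi2001, Thm. 2.3 (p. 79)] -/
theorem definiteRTControlPrime_of_facts' (hT : takahashi2001_thm_2_3_of_coprime)
    (h163 : PastenShimura2024_minimalDegree_le_163_mul) (h68 : PastenShimura2024_lemma_6_8) :
    DefiniteRTControlPrime :=
  definiteRTControlPrime_of_boundInClass (boundInClass_of_coprime hT) h163 h68

/-- **T2e.** … and K3 factors the same way (so the twin's orphan-free use is through the interface). -/
theorem definiteRTControlPrime_of_twin' (hTw : takahashi2001_thm_2_3_shimura_level)
    (h163 : PastenShimura2024_minimalDegree_le_163_mul) (h68 : PastenShimura2024_lemma_6_8) :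
    DefiniteRTControlPrime :=
  definiteRTControlPrime_of_boundInClass (boundInClass_of_twin hTw) h163 h68

end Summit.ABC.ABC.Cruxes.DefiniteRTControlPrime.StubIdeas2G3

end
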